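import Mathlib
import Literature.Computability.Complexity.Promise
import Literature.Computability.Complexity.PairPlumbing
import Literature.Computability.Complexity.NondeterministicProofs
import Literature.Computability.Complexity.TautCertificates
import Literature.Computability.MetaComplexity.AvgCaseTallyNE
import Literature.Computability.MetaComplexity.ThresholdWiresLightConeBounds
import Literature.Computability.MetaComplexity.FormulaXorAffineBounds
import Literature.Computability.MetaComplexity.OliveiraSanthanam2018.ApproxMCSPJuntaBounds
import Literature.Computability.MetaComplexity.OliveiraPichSanthanam2019.GapMKtPFormulaBPJuntaBounds
import Literature.Computability.MetaComplexity.ChenJinWilliams2019.SparseConstantDepthMagnification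
import Literature.Computability.MetaComplexity.ChenJinWilliams2019.SparseFormulaMagnification
import Literature.Computability.MetaComplexity.ChenTell2019.MajorityAndWires
import HarnessLib

/-!
# The tally language `1*` as a sparse `NP` witness against sublinear-budget circuit families

Support file (folklore, fully proved; no new definitions) for the census rows on
Chen–Jin–Williams, *Hardness magnification for all sparse NP languages* (FOCS 2019, TR19-118),
Theorem 1.1 with `C = NP`: the hypotheses `ChenJinWilliams2019.SparseNPTCHardAt c₀ d ε` (item 7,
`TC` circuits of depth `d + c₀(⌈log₂ 1/ε⌉+1)` with `⌈n^{1+ε}⌉` WIRES, census row R49) and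
`ChenJinWilliams2019.SparseNPFormulaXorHardAt ε` (item 2, `U₂-Formula-⊕` with `⌈n^{1+ε}⌉` parity
leaves, census row R48) ask, for every `β ∈ (0,1)`, for a `2^{n^β}`-sparse `NP` language outside the
class.  In print these hypotheses are wanted at some `ε > 0`.  This file proves them for EVERY
`ε < 0` (sublinear budgets), with ONE witness for all `β`: the tally language
`1* = {w | onesFn w = w} = {1ⁿ | n ∈ ℕ}` — `1`-sparse, in `P` (`AvgTallyNE.tallyFmt_mem_P`), hence
in `NP`, and at length `n` its slice is `AND_n`, which depends on every variable.

## The argument (light cone / junta, one length at a time)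

Every circuit class in these rows is an almost-everywhere family class `FamilyAE Q` whose members at
length `n` read at most `k(n)` input variables: `k = s + 1` for `s` wires and ANY gate basis and
depth (`Circuit.card_lightCone_le_wires_succ`), `k = t` for De Morgan / `B₂` formulas with `t`
leaves, `k = s` for deterministic branching programs with `s` inner nodes, and — in the affine
sense of `FormulaXorAffineBounds` — `k = t` for `U₂-Formula-⊕` trees with `t` parity leaves.  The
tree's junta lemmas (`OliveiraSanthanam2018.not_mem_promiseLift_FamilyAE_of_frequently` and its
twins) say: if infinitely often the target has a YES instance of length `n` and `< 2^{n-k(n)}`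
non-NO strings of length `n`, it is not decided.  For `1*` the YES instance is `1ⁿ` and the non-NO
strings of length `n` number exactly `1 < 2^{n-k(n)}` as soon as `k(n) < n`.  With the budget
`⌈n^e⌉`, `e < 1`, this holds for all large `n` (`eventually_mul_ceil_rpow_add_le`).

## Main statements

* `tally_not_mem_FamilyAE_of_lightCone`, `tally_not_mem_FamilyAE_of_xorLeafCount` — the generic
  forms; instances `tally_not_mem_TCdWIRESae` (every depth), `tally_not_mem_FORMULAXORae`,
  `tally_not_mem_FORMULAae`, `tally_not_mem_B2FORMULAae`, `tally_not_mem_BPSIZEae`.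
* `ChenJinWilliams2019.sparseNPTCHardAt_of_neg (c₀ d) (hε : ε < 0) : SparseNPTCHardAt c₀ d ε` —
  census row R49 (item 7), KNOWN side in the row's own predicate: every `ε < 0`, every `c₀, d`.
* `ChenJinWilliams2019.sparseNPFormulaXorHardAt_of_neg (hε : ε < 0) : SparseNPFormulaXorHardAt ε` —
  census row R48 (item 2; an EQUIVALENCE row in print, so this is calibration only).
* `ChenJinWilliams2019.exists_sparse_NP_not_mem_TCdWIRESae` — one `1`-sparse `NP` language outside
  `TCdWIRESae D ⌈n^e⌉` for every depth `D` and every exponent `e < 1` simultaneously in `β`.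
* BOUNDARY (`tally_mem_TCdWIRESae_powCeil`, `tally_mem_TCdWIRESae_tcDepth`): for `e ≥ 1` (resp.
  `ε ≥ 0`) and depth `≥ 1` the tally language IS in the wires class (one `∧ₙ` gate = one LTF gate,
  `n` wires, depth `1`; Chen–Tell's `AND`, `ChenTell2019.decides_single`) — the witness is exhausted
  exactly at exponent `1`; a `2^{n^β}`-sparse witness at `ε ≥ 0` would have to be a different
  language.

References: L. Chen, C. Jin, R. Williams, *Hardness magnification for all sparse NP languages*,
FOCS 2019 / ECCC TR19-118, Thm. 1.1 [key ChenJinWilliams2019]; S. Jukna, *Boolean Function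
Complexity* (2012), §1.1 (functions depending on all variables) [key Jukna2012]; R. V. Book, *Tally
languages and complexity classes*, Inf. Control 26 (1974) [folklore background for `1*`].
-/

open Finset Filter Topology Computability

namespace Literature.Computability.MetaComplexity

open Literature.Computability.Complexity Literature.Computability.Complexity.Circuit
open Literature.Computability.Complexity.PromiseProblem (ofLanguage)
open Literature.Computability.MetaComplexity.ChenJinWilliams2019
open scoped Classical

/-! ### The tally language: membership, slices, sparsity, `NP` -/

/-- `w ∈ 1*` iff `w` is the all-ones word of its length. [folklore] -/
theorem mem_tally_iff (w : List Bool) :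
    w ∈ {u : List Bool | onesFn u = u} ↔ w = List.replicate w.length true := by
  simp only [Set.mem_setOf_eq, onesFn, unaryEncodeNat_eq_replicate]
  exact eq_comm

/-- `1ⁿ ∈ 1*`. [folklore] -/
theorem replicate_mem_tally (n : ℕ) : List.replicate n true ∈ {u : List Bool | onesFn u = u} := by
  rw [mem_tally_iff, List.length_replicate]

/-- Vector form: `ofFn z ∈ 1*` iff `z` is the all-true vector. [folklore] -/
theorem ofFn_mem_tally_iff {n : ℕ} (z : Fin n → Bool) :
    List.ofFn z ∈ {u : List Bool | onesFn u = u} ↔ z = fun _ => true := by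
  rw [mem_tally_iff, List.length_ofFn, ← List.ofFn_const, List.ofFn_inj]

/-- The length-`n` slice of `1*` is `{1ⁿ}`. [folklore] -/
theorem tally_slice_eq (n : ℕ) :
    {x : List Bool | x ∈ {u : List Bool | onesFn u = u} ∧ x.length = n} =
      {List.replicate n true} := by
  ext x
  simp only [Set.mem_setOf_eq, Set.mem_singleton_iff]
  constructor
  · rintro ⟨hx, hlen⟩
    subst hlen
    exact (mem_tally_iff x).1 hx
  · rintro rfl
    exact ⟨replicate_mem_tally n, List.length_replicate⟩

/-- The length-`n` slice of `1*` has exactly one element. [folklore] -/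
theorem ncard_tally_slice (n : ℕ) :
    {x : List Bool | x ∈ {u : List Bool | onesFn u = u} ∧ x.length = n}.ncard = 1 := by
  rw [tally_slice_eq, Set.ncard_singleton]

/-- `1*` is `f`-sparse for every `f ≥ 1` (stated over `Language Bool` membership, as `IsSparse`
unfolds; the slice lemma is the `Set` form of the same term). [folklore] -/
theorem isSparse_tally {f : ℕ → ℕ} (hf : ∀ n, 1 ≤ f n) :
    IsSparse f {u : List Bool | onesFn u = u} := fun n =>
  (ncard_tally_slice n).le.trans (hf n)

/-- `1 ≤ ⌊2^{n^β}⌋` for every real `β` and every `n`. [folklore] -/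
theorem one_le_expSparsity (β : ℝ) (n : ℕ) : 1 ≤ expSparsity β n := by
  unfold expSparsity
  rw [Nat.one_le_floor_iff]
  calc (1 : ℝ) = (2 : ℝ) ^ (0 : ℝ) := (Real.rpow_zero 2).symm
    _ ≤ (2 : ℝ) ^ ((n : ℝ) ^ β) :=
        Real.rpow_le_rpow_of_exponent_le one_le_two (Real.rpow_nonneg (Nat.cast_nonneg n) β)

/-- `1*` is `2^{n^β}`-sparse for every `β`. [folklore] -/
theorem isSparse_expSparsity_tally (β : ℝ) :
    IsSparse (expSparsity β) {u : List Bool | onesFn u = u} :=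
  isSparse_tally (one_le_expSparsity β)

/-- `1* ∈ P` (the tree's `AvgTallyNE.tallyFmt_mem_P`). [folklore] -/
theorem tally_mem_P : {u : List Bool | onesFn u = u} ∈ Classes.P := AvgTallyNE.tallyFmt_mem_P

/-- `1* ∈ NP` (`P ⊆ NP`, `P_subset_NP_holds`). [folklore] -/
theorem tally_mem_NP : {u : List Bool | onesFn u = u} ∈ Nondeterministic.NP :=
  P_subset_NP_holds AvgTallyNE.tallyFmt_mem_P

/-! ### The counting input of the junta lemmas -/

/-- Exactly one vector of length `n` lies in `1*`. [folklore] -/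
theorem card_filter_ofFn_mem_tally (n : ℕ) :
    #{z : Fin n → Bool | List.ofFn z ∈ {u : List Bool | onesFn u = u}} = 1 := by
  rw [Finset.card_eq_one]
  refine ⟨fun _ => true, ?_⟩
  ext z
  rw [mem_filter, mem_singleton, ofFn_mem_tally_iff]
  simp

/-- The hypothesis of the tree's junta lemmas for the promise problem of `1*`: at every length `n`
with `k n < n` there is a YES instance (`1ⁿ`) and exactly `1 < 2^{n - k n}` non-NO strings.
[folklore] -/
theorem frequently_tally_witness {k : ℕ → ℕ} (hk : ∃ᶠ n : ℕ in atTop, k n < n) :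
    ∃ᶠ n : ℕ in atTop,
      (∃ y : Fin n → Bool, List.ofFn y ∈ (ofLanguage {u : List Bool | onesFn u = u}).yes) ∧
        #{z : Fin n → Bool | List.ofFn z ∉ (ofLanguage {u : List Bool | onesFn u = u}).no} <
          2 ^ (n - k n) := by
  refine hk.mono fun n hn => ⟨⟨fun _ => true, ?_⟩, ?_⟩
  · show List.ofFn (fun _ : Fin n => true) ∈ {u : List Bool | onesFn u = u}
    rw [List.ofFn_const]
    exact replicate_mem_tally n
  · have h1 :
        #{z : Fin n → Bool | List.ofFn z ∉ (ofLanguage {u : List Bool | onesFn u = u}).no} = 1 := by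
      rw [← card_filter_ofFn_mem_tally n]
      congr 1
      ext z
      simp only [mem_filter, mem_univ, true_and]
      exact Set.notMem_compl_iff
    rw [h1]
    exact Nat.one_lt_two_pow (by omega)

/-! ### Generic non-membership: light cone and parity-leaf juntas -/

/-- **`1*` is outside every a.e. family class of juntas**: if every circuit allowed at length `n`
reads at most `k n` variables and `k n < n` infinitely often, then `1* ∉ FamilyAE Q`. [folklore] -/
theorem tally_not_mem_FamilyAE_of_lightCone {Q : ∀ n : ℕ, Circuit (Fin n) → Prop} {k : ℕ → ℕ}
    (hQ : ∀ n (C : Circuit (Fin n)), Q n C → C.lightCone.card ≤ k n)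
    (hk : ∃ᶠ n : ℕ in atTop, k n < n) : {u : List Bool | onesFn u = u} ∉ FamilyAE Q := fun h =>
  OliveiraSanthanam2018.not_mem_promiseLift_FamilyAE_of_frequently hQ (frequently_tally_witness hk)
    (ofLanguage_mem_promiseLift_iff.2 h)

/-- The affine twin: families whose members have at most `k n` parity leaves (`xorLeafCount`).
[folklore] -/
theorem tally_not_mem_FamilyAE_of_xorLeafCount {Q : ∀ n : ℕ, Circuit (Fin n) → Prop} {k : ℕ → ℕ}
    (hQ : ∀ n (C : Circuit (Fin n)), Q n C → C.xorLeafCount ≤ k n)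
    (hk : ∃ᶠ n : ℕ in atTop, k n < n) : {u : List Bool | onesFn u = u} ∉ FamilyAE Q := fun h =>
  not_mem_promiseLift_FamilyAE_of_frequently_xorLeafCount hQ (frequently_tally_witness hk)
    (ofLanguage_mem_promiseLift_iff.2 h)

/-! ### Instances: threshold wires (any depth), formulas, branching programs -/

/-- **`1*` needs `n - 1` wires at every depth**: `1* ∉ TCdWIRESae D s` whenever `s n + 1 < n`
infinitely often (LTF gates, `acDepth ≤ D`, wires, a.e.). [folklore] -/
theorem tally_not_mem_TCdWIRESae (D : ℕ) {s : ℕ → ℕ} (hs : ∃ᶠ n : ℕ in atTop, s n + 1 < n) :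
    {u : List Bool | onesFn u = u} ∉ TCdWIRESae D s := fun h =>
  not_mem_promiseLift_TCdWIRESae_of_frequently (D := D) (frequently_tally_witness hs)
    (ofLanguage_mem_promiseLift_iff.2 h)

/-- `1* ∉ FORMULAXORae t` whenever `t n < n` infinitely often (`U₂-Formula-⊕`, parity leaves).
[folklore] -/
theorem tally_not_mem_FORMULAXORae {t : ℕ → ℕ} (ht : ∃ᶠ n : ℕ in atTop, t n < n) :
    {u : List Bool | onesFn u = u} ∉ FORMULAXORae t := fun h =>
  not_mem_promiseLift_FORMULAXORae_of_frequently (frequently_tally_witness ht)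
    (ofLanguage_mem_promiseLift_iff.2 h)

/-- `1* ∉ FORMULAae t` whenever `t n < n` infinitely often (De Morgan formulas, leaves).
[folklore] -/
theorem tally_not_mem_FORMULAae {t : ℕ → ℕ} (ht : ∃ᶠ n : ℕ in atTop, t n < n) :
    {u : List Bool | onesFn u = u} ∉ FORMULAae t := fun h =>
  OliveiraSanthanam2018.not_mem_promiseLift_FORMULAae_of_frequently (frequently_tally_witness ht)
    (ofLanguage_mem_promiseLift_iff.2 h)

/-- `1* ∉ B2FORMULAae t` whenever `t n < n` infinitely often (`B₂` formulas, leaves). [folklore] -/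
theorem tally_not_mem_B2FORMULAae {t : ℕ → ℕ} (ht : ∃ᶠ n : ℕ in atTop, t n < n) :
    {u : List Bool | onesFn u = u} ∉ B2FORMULAae t := fun h =>
  OliveiraPichSanthanam2019.not_mem_promiseLift_B2FORMULAae_of_frequently
    (frequently_tally_witness ht) (ofLanguage_mem_promiseLift_iff.2 h)

/-- `1* ∉ BPSIZEae k` whenever `k n < n` infinitely often (deterministic branching programs, inner
nodes). [folklore] -/
theorem tally_not_mem_BPSIZEae {k : ℕ → ℕ} (hk : ∃ᶠ n : ℕ in atTop, k n < n) :
    {u : List Bool | onesFn u = u} ∉ BPSIZEae k := fun h =>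
  OliveiraPichSanthanam2019.not_mem_promiseLift_BPSIZEae_of_frequently
    (frequently_tally_witness hk) (ofLanguage_mem_promiseLift_iff.2 h)

/-! ### Sublinear budgets `a·⌈n^e⌉ + c`, `e < 1` -/

/-- For `κ < 1`: `a·⌈n^κ⌉ + c ≤ n` for all large `n`. [folklore] -/
theorem eventually_mul_ceil_rpow_add_le {κ : ℝ} (hκ : κ < 1) (a c : ℕ) :
    ∀ᶠ n : ℕ in atTop, a * ⌈(n : ℝ) ^ κ⌉₊ + c ≤ n := by
  set κ' : ℝ := max κ 0 with hκ'def
  have hκ'1 : κ' < 1 := max_lt hκ one_pos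
  have hκ'0 : 0 ≤ κ' := le_max_right _ _
  have hlim : Tendsto (fun n : ℕ => (n : ℝ) ^ (1 - κ')) atTop atTop :=
    (tendsto_rpow_atTop (by linarith)).comp tendsto_natCast_atTop_atTop
  filter_upwards [hlim.eventually_ge_atTop (2 * (a : ℝ) + c + 1), eventually_ge_atTop 1]
    with n hn hn1
  have hn1' : (1 : ℝ) ≤ (n : ℝ) := by exact_mod_cast hn1
  have hnpos : (0 : ℝ) < (n : ℝ) := by linarith
  have hmono : (n : ℝ) ^ κ ≤ (n : ℝ) ^ κ' :=
    Real.rpow_le_rpow_of_exponent_le hn1' (le_max_left _ _)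
  have hone : (1 : ℝ) ≤ (n : ℝ) ^ κ' := Real.one_le_rpow hn1' hκ'0
  have hsplit : (n : ℝ) ^ κ' * (n : ℝ) ^ (1 - κ') = n := by
    rw [← Real.rpow_add hnpos]
    norm_num
  have hceil : (⌈(n : ℝ) ^ κ⌉₊ : ℝ) < (n : ℝ) ^ κ + 1 :=
    Nat.ceil_lt_add_one (Real.rpow_nonneg (Nat.cast_nonneg n) κ)
  have h2 : (n : ℝ) ^ κ' * (2 * (a : ℝ) + c + 1) ≤ (n : ℝ) ^ κ' * (n : ℝ) ^ (1 - κ') :=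
    mul_le_mul_of_nonneg_left hn (by positivity)
  rw [hsplit] at h2
  have ha : (0 : ℝ) ≤ a := Nat.cast_nonneg a
  have hc : (0 : ℝ) ≤ c := Nat.cast_nonneg c
  have key : (a : ℝ) * ((n : ℝ) ^ κ + 1) + c ≤ n := by nlinarith
  have : (((a * ⌈(n : ℝ) ^ κ⌉₊ + c : ℕ)) : ℝ) ≤ n := by
    push_cast
    nlinarith
  exact_mod_cast this

/-- The `powCeil` form: for `e < 1`, `a·powCeil e n + c ≤ n` for all large `n`. [folklore] -/
theorem eventually_mul_powCeil_add_le {e : ℝ} (he : e < 1) (a c : ℕ) :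
    ∀ᶠ n : ℕ in atTop, a * powCeil e n + c ≤ n :=
  eventually_mul_ceil_rpow_add_le he a c

/-- For `e < 1`: `powCeil e n + c < n` for all large `n`. [folklore] -/
theorem eventually_powCeil_add_lt {e : ℝ} (he : e < 1) (c : ℕ) :
    ∀ᶠ n : ℕ in atTop, powCeil e n + c < n := by
  filter_upwards [eventually_mul_powCeil_add_le he 1 (c + 1)] with n hn
  omega

/-- **`1*` is outside `TC` circuits of any depth with `⌈n^e⌉` wires, `e < 1`.** [folklore] -/
theorem tally_not_mem_TCdWIRESae_powCeil (D : ℕ) {e : ℝ} (he : e < 1) :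
    {u : List Bool | onesFn u = u} ∉ TCdWIRESae D (powCeil e) :=
  tally_not_mem_TCdWIRESae D (eventually_powCeil_add_lt he 1).frequently

/-- `1*` is outside `U₂-Formula-⊕[⌈n^e⌉]` for `e < 1`. [folklore] -/
theorem tally_not_mem_FORMULAXORae_powCeil {e : ℝ} (he : e < 1) :
    {u : List Bool | onesFn u = u} ∉ FORMULAXORae (powCeil e) :=
  tally_not_mem_FORMULAXORae (eventually_powCeil_add_lt he 0).frequently

/-- `1*` is outside `U₂-Formula[⌈n^e⌉]` for `e < 1`. [folklore] -/
theorem tally_not_mem_FORMULAae_powCeil {e : ℝ} (he : e < 1) :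
    {u : List Bool | onesFn u = u} ∉ FORMULAae (powCeil e) :=
  tally_not_mem_FORMULAae (eventually_powCeil_add_lt he 0).frequently

/-- `1*` is outside `B₂-Formula[⌈n^e⌉]` for `e < 1`. [folklore] -/
theorem tally_not_mem_B2FORMULAae_powCeil {e : ℝ} (he : e < 1) :
    {u : List Bool | onesFn u = u} ∉ B2FORMULAae (powCeil e) :=
  tally_not_mem_B2FORMULAae (eventually_powCeil_add_lt he 0).frequently

/-- `1*` is outside `BP[⌈n^e⌉]` for `e < 1`. [folklore] -/
theorem tally_not_mem_BPSIZEae_powCeil {e : ℝ} (he : e < 1) :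
    {u : List Bool | onesFn u = u} ∉ BPSIZEae (powCeil e) :=
  tally_not_mem_BPSIZEae (eventually_powCeil_add_lt he 0).frequently

/-! ### The boundary of the witness: at exponent `≥ 1` the tally language IS in the class -/

/-- `w ∈ 1*` iff every letter of `w` is `1`. [folklore] -/
theorem mem_tally_iff_forall_get (x : List Bool) :
    x ∈ {u : List Bool | onesFn u = u} ↔ ∀ i : Fin x.length, x.get i = true := by
  rw [mem_tally_iff, List.eq_replicate_iff]
  constructor
  · rintro ⟨-, h⟩ i
    exact h _ (List.get_mem x i)
  · intro h
    refine ⟨rfl, fun b hb => ?_⟩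
    obtain ⟨i, rfl⟩ := List.get_of_mem hb
    exact h i

/-- `1*` is Chen–Tell's language `AND` (`x ∈ AND ↔ ∧ᵢ xᵢ = 1`). [folklore] -/
theorem tally_eq_AND : {u : List Bool | onesFn u = u} = ChenTell2019.AND := by
  ext x
  rw [mem_tally_iff_forall_get]
  change _ ↔ decide (∀ i : Fin x.length, x.get i = true) = true
  rw [decide_eq_true_iff]

/-- **The one-gate family `∧ₙ` decides `1*` with `n` wires at depth `1`**: for every depth `D ≥ 1`
and every wire budget eventually `≥ n`, `1* ∈ TCdWIRESae D s`.  So the `1`-sparse witness of this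
file is exhausted exactly at budget exponent `1` (`ε = 0` in the rows' `n^{1+ε}`). [folklore] -/
theorem tally_mem_TCdWIRESae {D : ℕ} (hD : 1 ≤ D) {s : ℕ → ℕ} (hs : ∃ n₀ : ℕ, ∀ n ≥ n₀, n ≤ s n) :
    {u : List Bool | onesFn u = u} ∈ TCdWIRESae D s := by
  obtain ⟨n₀, hn₀⟩ := hs
  refine ⟨fun n => Circuit.single (GateFn.and n) (finCongr rfl), ⟨n₀, fun n hn => ⟨?_, ?_, ?_⟩⟩, ?_⟩
  · exact Circuit.single_isOver (isLTF_and n) _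
  · exact (ChenTell2019.acDepth_single_le _ _).trans hD
  · rw [ChenTell2019.wires_single]
    exact hn₀ n hn
  · rw [tally_eq_AND]
    exact ChenTell2019.decides_single GateFn.and (fun _ => rfl) ChenTell2019.AND fun x => Iff.rfl

/-- At budget `⌈n^e⌉` with `e ≥ 1` and any depth `D ≥ 1` the tally language is INSIDE the wires
class — the exact boundary of `tally_not_mem_TCdWIRESae_powCeil` (`e < 1`). [folklore] -/
theorem tally_mem_TCdWIRESae_powCeil {D : ℕ} (hD : 1 ≤ D) {e : ℝ} (he : 1 ≤ e) :
    {u : List Bool | onesFn u = u} ∈ TCdWIRESae D (powCeil e) := by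
  refine tally_mem_TCdWIRESae hD ⟨1, fun n hn => ?_⟩
  unfold powCeil
  have h1 : (n : ℝ) ≤ (n : ℝ) ^ e := by
    calc (n : ℝ) = (n : ℝ) ^ (1 : ℝ) := (Real.rpow_one _).symm
      _ ≤ (n : ℝ) ^ e := Real.rpow_le_rpow_of_exponent_le (by exact_mod_cast hn) he
  exact_mod_cast h1.trans (Nat.le_ceil _)

/-- In the row's vocabulary: at every `ε ≥ 0` and every `(c₀, d)` with `d ≥ 1` the tally language
lies in `TCdWIRESae (tcDepth c₀ d ε) ⌈n^{1+ε}⌉`, so it cannot witness `SparseNPTCHardAt c₀ d ε`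
there — the KNOWN side below is sharp for this witness. [folklore] -/
theorem tally_mem_TCdWIRESae_tcDepth (c₀ : ℕ) {d : ℕ} (hd : 1 ≤ d) {ε : ℝ} (hε : 0 ≤ ε) :
    {u : List Bool | onesFn u = u} ∈ TCdWIRESae (tcDepth c₀ d ε) (powCeil (1 + ε)) :=
  tally_mem_TCdWIRESae_powCeil (hd.trans (le_tcDepth c₀ d ε)) (by linarith)

/-! ### The census cells in the rows' own predicates -/

namespace ChenJinWilliams2019

/-- **One sparse `NP` witness for all `β` and all depths**: for every depth `D` and every exponent
`e < 1` the tally language is an `NP` language, `2^{n^β}`-sparse for every `β`, outside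
`TCdWIRESae D ⌈n^e⌉`. [folklore] -/
theorem exists_sparse_NP_not_mem_TCdWIRESae (D : ℕ) {e : ℝ} (he : e < 1) :
    ∃ L : Language Bool, L ∈ Nondeterministic.NP ∧ (∀ β : ℝ, IsSparse (expSparsity β) L) ∧
      IsSparse (fun _ => 1) L ∧ L ∉ TCdWIRESae D (powCeil e) :=
  ⟨{u : List Bool | onesFn u = u}, tally_mem_NP, isSparse_expSparsity_tally,
    isSparse_tally fun _ => le_rfl,
    tally_not_mem_TCdWIRESae_powCeil D he⟩

/-- **Census row R49 (Thm. 1.1 item 7, `C = NP`), KNOWN side in the row's own predicate: the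
hypothesis `SparseNPTCHardAt c₀ d ε` holds for EVERY `ε < 0`** (every `c₀`, every `d`; the depth
allowance `tcDepth c₀ d ε` is irrelevant — the witness `1*` beats every depth), versus NEEDED: some
`ε ∈ (0,1)` (`MagnificationGapCensus.gap_R49_tc c₀ d`). [folklore] -/
theorem sparseNPTCHardAt_of_neg (c₀ d : ℕ) {ε : ℝ} (hε : ε < 0) : SparseNPTCHardAt c₀ d ε :=
  fun β _ _ => ⟨{u : List Bool | onesFn u = u}, tally_mem_NP, isSparse_expSparsity_tally β,
    tally_not_mem_TCdWIRESae_powCeil _ (by linarith)⟩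

/-- The same cell at every depth `D` in place of `tcDepth c₀ d ε`: for `e < 1` and every
`β ∈ (0,1)` (indeed every `β`) some `2^{n^β}`-sparse `NP` language is outside `TCdWIRESae D ⌈n^e⌉`.
[folklore] -/
theorem sparseNP_not_mem_TCdWIRESae_of_lt_one (D : ℕ) {e : ℝ} (he : e < 1) (β : ℝ) :
    ∃ L : Language Bool, L ∈ Nondeterministic.NP ∧ IsSparse (expSparsity β) L ∧
      L ∉ TCdWIRESae D (powCeil e) :=
  ⟨{u : List Bool | onesFn u = u}, tally_mem_NP, isSparse_expSparsity_tally β,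
    tally_not_mem_TCdWIRESae_powCeil D he⟩

/-- **Census row R48 (Thm. 1.1 item 2, `C = NP`; an EQUIVALENCE row in print — calibration only):
`SparseNPFormulaXorHardAt ε` holds for every `ε < 0`.** [folklore] -/
theorem sparseNPFormulaXorHardAt_of_neg {ε : ℝ} (hε : ε < 0) : SparseNPFormulaXorHardAt ε :=
  fun β _ _ => ⟨{u : List Bool | onesFn u = u}, tally_mem_NP, isSparse_expSparsity_tally β,
    tally_not_mem_FORMULAXORae_powCeil (by linarith)⟩

/-- Items 3–5 calibration (thresholds `n^{2+ε}`, `n^{3+ε}`, `n^{2+ε}`): the hypotheses hold once the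
budget exponent drops below `1`, i.e. `SparseNPB2FormulaHardAt ε` for `ε < -1`,
`SparseNPFormulaHardAt ε` for `ε < -2`, `SparseNPBPHardAt ε` for `ε < -1` — recorded only to mark
where the `1`-sparse witness stops. [folklore] -/
theorem sparseNP_items345_of_sublinear :
    (∀ ε : ℝ, ε < -1 → SparseNPB2FormulaHardAt ε) ∧ (∀ ε : ℝ, ε < -2 → SparseNPFormulaHardAt ε) ∧
      (∀ ε : ℝ, ε < -1 → SparseNPBPHardAt ε) :=
  ⟨fun ε hε β _ _ => ⟨{u : List Bool | onesFn u = u}, tally_mem_NP, isSparse_expSparsity_tally β,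
      tally_not_mem_B2FORMULAae_powCeil (by linarith)⟩,
    fun ε hε β _ _ => ⟨{u : List Bool | onesFn u = u}, tally_mem_NP, isSparse_expSparsity_tally β,
      tally_not_mem_FORMULAae_powCeil (by linarith)⟩,
    fun ε hε β _ _ => ⟨{u : List Bool | onesFn u = u}, tally_mem_NP, isSparse_expSparsity_tally β,
      tally_not_mem_BPSIZEae_powCeil (by linarith)⟩⟩

end ChenJinWilliams2019

end Literature.Computability.MetaComplexity
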